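import Literature.Computability.Complexity.HamCircuitNP

set_option linter.dupNamespace false

/-!
# The independent-set verifier is in `P`

Stub T2a (`stub_indepVerifier`) of line `SketchIdeator1` for the crux
`Summit.PneNP.PneNP.Theses.PhaseTwins.NoFBPPApproxAboveUniqueness` (stmt-PneNP-2717). It serves the
`#P`-membership of the hard-core count (route support item `HardcoreCountSharpP`), whose witnesses are
the characteristic vectors `z ∈ {0,1}ⁿ` of the independent vertex sets of the coded graph.

There is a `P` language `V` which, on a graph code word `encodingGraph.encode ⟨n, G⟩ = ⟨encodeNat n,
adjBits n G⟩` paired with a string `z`, accepts iff `|z| = n` and the chosen set `{i | z i = 1}` is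
independent in `G`. The verifier is the clique verifier of `KarpCliqueNP.lean` (Karp 1972, Main
Theorem, problem 3: `CliqueNP.verifT = lenT ∧ cntT ∧ prT`) with the count test dropped and the pair
piece NEGATED in its consequent: over the flat index `t = i n + j < n²` (`Brick.allIdxFn`, yardstick
the bit field), `z[i] ∧ z[j] ∧ i ≠ j → ¬ bits[t]` (`iteFn`/`andFn`/`notFn` on the pieces
`CliqueNP.pYI`, `pYJ`, `pEq`, `pB`). Those pieces read the `CLIQUE` instance format `⟨⟨nc, bits⟩, kc⟩`;
the pair `⟨x, z⟩` is first sent to `⟨⟨x, ε⟩, z⟩ = ⟨instEnc.encode (⟨n, G⟩, 0), z⟩` (`ε = encodeNat 0`)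
by an `FP` map, so that the value computations of `KarpCliqueNP.lean` apply with `k = 0`, and `V` is
the `FP` preimage (`preimage_mem_P`) of a language cut out by a one-bit `FP` test
(`CliqueNP.mem_P_of_oneBit`). No machine is written and no definition is introduced (the test is
assembled inside the proof with `set`).

## References

* R. M. Karp, *Reducibility among combinatorial problems*, in: R. E. Miller, J. W. Thatcher (eds.),
  Complexity of Computer Computations, Plenum 1972, 85–103: §4 Main Theorem, problem 3 (CLIQUE; the
  same verifier with the adjacency bit negated checks independence) [Karp1972].
* S. Arora, B. Barak, *Computational Complexity: A Modern Approach*, CUP 2009, Def. 1.13, §1.3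
  (closure of polynomial time under composition and bounded loops) [AroraBarakCC2009].
-/

namespace Summit.PneNP.PneNP.Theorems.NoFBPPApproxAboveUniqueness

open Literature.Computability.Complexity _root_.Computability Polynomial Brick Plumb OracleCompose HashBricks
open CliqueNP

/-- **Values of the clique-verifier pieces** `pYI`, `pYJ`, `pB`, `pEq` of `KarpCliqueNP.lean` on
`⟨⟨instEnc.encode (⟨n, G⟩, k), y⟩, 1ᵗ⟩`: the witness bits `y (t / n)` and `y (t % n)`, the adjacency
bit `bits t` and the diagonal test `[t / n = t % n]` (the computations inside
`CliqueNP.pairPiece_encode`, exported). [folklore] -/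
theorem cliquePieces_encode (n : ℕ) (G : SimpleGraph (Fin n)) (k : ℕ) (y : List Bool) (t : ℕ) :
    pYI (boolPair (boolPair (instEnc.encode (⟨n, G⟩, k)) y) (ones t)) = [y.getD (t / n) false] ∧
    pYJ (boolPair (boolPair (instEnc.encode (⟨n, G⟩, k)) y) (ones t)) = [y.getD (t % n) false] ∧
    pB (boolPair (boolPair (instEnc.encode (⟨n, G⟩, k)) y) (ones t)) = [(adjBits n G).getD t false] ∧
    pEq (boolPair (boolPair (instEnc.encode (⟨n, G⟩, k)) y) (ones t)) = [decide (t / n = t % n)] := by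
  set w := boolPair (instEnc.encode (⟨n, G⟩, k)) y with hw
  obtain ⟨hnc, hbits, -⟩ := proj_encode n G k
  have hN : pN (boolPair w (ones t)) = ones n := by
    simp only [pN, Function.comp_apply, fanoutFn_apply, fstF_boolPair, hw, hnc]
    rw [binToUnaryFn_boolPair, bitsToNat_encodeNat, min_eq_left (n_le_length_pair n G k y)]
  have hij : pIJ (boolPair w (ones t)) = boolPair (ones (t / n)) (ones (t % n)) := by
    rw [pIJ, Function.comp_apply, fanoutFn_apply, hN, sndF_boolPair, divModFn_boolPair]
  have hy : sndF (fstF (boolPair w (ones t))) = y := by rw [fstF_boolPair, hw, sndF_boolPair]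
  refine ⟨?_, ?_, ?_, ?_⟩
  · rw [pYI, Function.comp_apply, Function.comp_apply, fanoutFn_apply, Function.comp_apply, hij, fstF_boolPair,
      Function.comp_apply, hy, dropFn_boolPair, headBitFn_apply, List.length_replicate, headD_drop]
  · rw [pYJ, Function.comp_apply, Function.comp_apply, fanoutFn_apply, Function.comp_apply, hij, sndF_boolPair,
      Function.comp_apply, hy, dropFn_boolPair, headBitFn_apply, List.length_replicate, headD_drop]
  · simp only [pB, Function.comp_apply, fanoutFn_apply, sndF_boolPair, fstF_boolPair, hw, hbits]
    rw [bitAtFn_boolPair, headBitFn_apply, List.length_replicate, headD_take_one_drop]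
  · rw [pEq, Function.comp_apply, hij, eqPairFn_boolPair]
    simp only [ones_inj]

/-- **Value of the independence piece** `y[t / n] ∧ y[t % n] ∧ t / n ≠ t % n → ¬ bits[t]` (the pair
piece of the clique verifier with its consequent negated) on `⟨⟨instEnc.encode (⟨n, G⟩, k), y⟩, 1ᵗ⟩`.
[cite: Karp1972, §4 Main Theorem, problem 3] -/
theorem indepPiece_encode (n : ℕ) (G : SimpleGraph (Fin n)) (k : ℕ) (y : List Bool) (t : ℕ) :
    iteFn (andFn pYI (andFn pYJ (notFn pEq))) (notFn pB) (fun _ => [true])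
        (boolPair (boolPair (instEnc.encode (⟨n, G⟩, k)) y) (ones t)) =
      [!(y.getD (t / n) false && (y.getD (t % n) false && !decide (t / n = t % n))) ||
        !(adjBits n G).getD t false] := by
  obtain ⟨hyi, hyj, hb, heq⟩ := cliquePieces_encode n G k y t
  rw [iteFn_apply (andFn_apply hyi (andFn_apply hyj (notFn_apply heq))), notFn_apply hb]
  cases y.getD (t / n) false <;> cases y.getD (t % n) false <;> by_cases h : t / n = t % n <;> simp [h]

open Classical in
/-- **The independence piece holds at every flat index iff the chosen vertices are pairwise
non-adjacent** (the diagonal `i = j` costs nothing: `G.Adj` is irreflexive).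
[cite: Karp1972, §4 Main Theorem, problem 3] -/
theorem forall_indepAt_iff {n : ℕ} (G : SimpleGraph (Fin n)) (y : List Bool) :
    (∀ t < n * n, (!(y.getD (t / n) false && (y.getD (t % n) false && !decide (t / n = t % n))) ||
        !(adjBits n G).getD t false) = true) ↔
      ∀ i j : Fin n, y.getD i false = true → y.getD j false = true → ¬ G.Adj i j := by
  constructor
  · intro h i j hi hj hadj
    have ht := h _ (flat_lt i j)
    rw [flat_div, flat_mod, getD_adjBits_flat, hi, hj, decide_eq_true hadj] at ht
    have hne : ¬ ((i : ℕ) = j) := fun e => G.ne_of_adj hadj (Fin.ext e)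
    simp [hne] at ht
  · intro h t ht
    rw [getD_adjBits G ht]
    cases hi : y.getD (t / n) false
    · simp
    · cases hj : y.getD (t % n) false
      · simp
      · by_cases hd : t / n = t % n
        · simp [hd]
        · have hadj := h ⟨t / n, div_lt_of_lt_mul ht⟩ ⟨t % n, Nat.mod_lt _ (pos_of_lt_mul ht)⟩ hi hj
          simp [hd, hadj]

/-- **Stub T2a (the independent-set verifier).** There is a `P` language `V` which, on a graph code word
`encode ⟨n, G⟩` paired with a string `z`, accepts iff `z` is the characteristic vector of a vertex set
(`|z| = n`) that is independent in `G` (pattern of `CliqueNP.verifT` / `CliqueNP.prT`, Karp 1972, with the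
pair test negated: `z[i] ∧ z[j] ∧ i ≠ j → ¬ bit (in+j)`), run after the `FP` format map
`⟨x, z⟩ ↦ ⟨⟨x, ε⟩, z⟩` (a `CLIQUE` instance with `k = 0`). Off code words `V` is unconstrained.
[cite: Karp1972, §4 Main Theorem, problem 3] -/
theorem stub_indepVerifier :
    ∃ V ∈ Classes.P, ∀ (n : ℕ) (G : SimpleGraph (Fin n)) (z : List Bool),
      boolPair (encodingGraph.encode ⟨n, G⟩) z ∈ V ↔
        z.length = n ∧ ∀ i j : Fin n, z.getD i false = true → z.getD j false = true → ¬ G.Adj i j := by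
  -- the independence piece, its index-all fold over the bit field, the format map `⟨x, z⟩ ↦ ⟨⟨x, ε⟩, z⟩`
  set piece : List Bool → List Bool :=
    iteFn (andFn pYI (andFn pYJ (notFn pEq))) (notFn pB) (fun _ => [true]) with hpiece
  set prI : List Bool → List Bool := allIdxFn (bitsF ∘ fstF) piece with hprI
  set ρ : List Bool → List Bool := fanoutFn (fanoutFn fstF fun _ => []) sndF with hρ
  have h1piece : OneBit piece :=
    (oneBit_andFn oneBit_pYI (oneBit_andFn oneBit_pYJ (oneBit_notFn oneBit_pEq))).ite
      (oneBit_notFn oneBit_pB) (oneBit_const true)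
  have hFPpiece : piece ∈ FP :=
    iteFn_mem_FP (andFn_mem_FP pYI_mem_FP (andFn_mem_FP pYJ_mem_FP (notFn_mem_FP pEq_mem_FP)))
      (notFn_mem_FP pB_mem_FP) (const_mem_FP _)
  have h1prI : OneBit prI := oneBit_allIdxFn h1piece length_bitsF_fstF_le
  have hFPprI : prI ∈ FP := allIdxFn_mem_FP (comp_mem_FP bitsF_mem_FP fstF_mem_FP) hFPpiece h1piece
  have hV : ({w | andFn lenT prI w = [true]} : Language Bool) ∈ Classes.P :=
    mem_P_of_oneBit (andFn_mem_FP lenT_mem_FP hFPprI) (oneBit_andFn oneBit_lenT h1prI)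
  have hFPρ : ρ ∈ FP := fanoutFn_mem_FP (fanoutFn_mem_FP fstF_mem_FP (const_mem_FP _)) sndF_mem_FP
  refine ⟨ρ ⁻¹' {w | andFn lenT prI w = [true]}, preimage_mem_P hV hFPρ, fun n G z => ?_⟩
  -- `ρ ⟨encode ⟨n, G⟩, z⟩ = ⟨instEnc.encode (⟨n, G⟩, 0), z⟩` (`encodeNat 0 = ε`)
  have hρw : ρ (boolPair (encodingGraph.encode ⟨n, G⟩) z) = boolPair (instEnc.encode (⟨n, G⟩, 0)) z := by
    rw [hρ, fanoutFn_apply, fanoutFn_apply, fstF_boolPair, sndF_boolPair]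
    rfl
  set w := boolPair (instEnc.encode (⟨n, G⟩, 0)) z with hw
  obtain ⟨hnc, hbits, -⟩ := proj_encode n G 0
  -- the length test
  have hlen : lenT w = [decide (z.length = n)] := by
    rw [lenT, Function.comp_apply, fanoutFn_apply, Function.comp_apply, hw, sndF_boolPair, lenBinF_apply,
      Function.comp_apply, fstF_boolPair, hnc, eqPairFn_boolPair]
    simp only [encodeNat_inj]
  -- the independence test
  have hpr : prI w = [decide (∀ t < n * n,
      (!(z.getD (t / n) false && (z.getD (t % n) false && !decide (t / n = t % n))) ||
        !(adjBits n G).getD t false) = true)] := by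
    rw [hprI, allIdxFn_apply h1piece (length_bitsF_fstF_le w)]
    have hl : ((bitsF ∘ fstF) w).length = n * n := by
      rw [Function.comp_apply, hw, fstF_boolPair, hbits, length_adjBits]
    refine congrArg (fun b => [b]) (Bool.decide_congr ?_)
    rw [hl]
    simp only [hw, hpiece, indepPiece_encode, List.cons.injEq, and_true]
  change andFn lenT prI (ρ (boolPair (encodingGraph.encode ⟨n, G⟩) z)) = [true] ↔ _
  rw [hρw, andFn_decide hlen hpr, HamNP.singleton_decide_eq_true_iff, forall_indepAt_iff G z]

end Summit.PneNP.PneNP.Theorems.NoFBPPApproxAboveUniqueness
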